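import Summits.Ventures.PercRepro.MSTightOneVertexCount
import Summits.Ventures.PercRepro.MSTightRStarMReduction

/-!
# THEOREM (R*-M) PROPER: every instance has a witness

Dossier proofs/MINE1-theoremS.md, Addenda 38–40, and proofs/MINE1-RSTARM-PROOF.md. Theorem B
(`OneVertexData.false`, MSTightOneVertexCount.lean) says that a one-vertex residue instance
without a witness does not exist; so every instance on a ground set `insert m u` (`m ∉ u`) has a
witness — the tight case by (F3), the case of no member through `m` by (F6), the rest by
Theorem B — which is the candidate Prop `OneVertexWitness α` of MSTightRStarMReduction.lean
(`oneVertexWitness`). With the reduction `RInst.exists_witness_of_oneVertexWitness` (the merge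
of Addendum 39 Step 2 and the lift of Step 3) this gives **Theorem (R*-M) proper**
(`RInst.exists_witness`): in every instance `RInst S L' T u` some member of `T` lies in `L'`.
-/

namespace PercRepro.MSTight

open Finset
open scoped FinsetFamily

variable {α : Type*} [DecidableEq α] [Fintype α]

/-- **Theorem B (Addendum 38 §4):** every instance on a ground set `insert m u` with `m ∉ u`
has a witness. -/
theorem oneVertexWitness : OneVertexWitness α := by
  intro u L' T m hmu h
  by_contra hnw
  have hnw' : ∀ t ∈ T, t ∉ L' := fun t ht htL => hnw ⟨t, ht, htL⟩
  have hnt : ¬ Tight T := by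
    intro hF
    obtain ⟨y, hy, -, hyL⟩ := h.exists_witness_of_tight hF
    exact hnw' y hy hyL
  have hmT : ∃ y ∈ T, m ∈ y := by
    by_contra hno
    have hTu : ∀ y ∈ T, y ⊆ u := by
      intro y hy a ha
      have := h.hTS y hy ha
      rw [mem_insert] at this
      rcases this with rfl | h'
      · exact absurd ⟨y, hy, ha⟩ hno
      · exact h'
    obtain ⟨y, hy, hyL⟩ := h.exists_witness_of_forall_subset hTu
    exact hnw' y hy hyL
  exact OneVertexData.false ⟨h, hmu, hnt, hmT, hnw'⟩

namespace RInst

variable {S u : Finset α} {L' T : Finset (Finset α)}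

/-- **THEOREM (R*-M) PROPER.** Every instance has a witness: some member of `T` lies in `L'`. -/
theorem exists_witness (h : RInst S L' T u) : ∃ y ∈ T, y ∈ L' :=
  h.exists_witness_of_oneVertexWitness oneVertexWitness

end RInst

end PercRepro.MSTight
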